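import Summits.AtomisticToContinuum.HydrodynamicLimit.Theses.OneFlightGossipEngine
import Summits.AtomisticToContinuum.HydrodynamicLimit.Theorems.OneFlightGossipEngineKineticCurrentsWindowLDApriori

/-!
# Crux `KineticCurrentsLDAlongFamilies` (stmt-AtomisticToContinuum-16659) — ideator 1, round 1

First lemmas of the crux idea `profile-axis-compactness-transfer`
(card `idea-profile-axis-compactness-transfer.md`), typed over existing declarations.

* `RenyiTransferLocalGibbs` — FIRST LEMMA (static, measure side): Hölder–Rényi continuity of the
  canonical local Gibbs laws in the profile data `(a, θ, u)`, UNIFORM IN `N`: the Radon–Nikodym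
  derivative of two local Gibbs laws with the same `σ, N, Φ` is overlap-free (the hard-core
  indicator and the flow cancel), a product of one-body Gaussian/activity ratios, so the Rényi
  divergence of any order is `(N+1)·c(δ)` with `c(δ) → 0`.
* `WeightedClosureAlongFlow` — second static lemma (observable side; precedent: `WeightedClosure`
  of the sibling card weak-star-covering-chaos-defect on stmt-14442): energy conservation pins the
  window functional of a `(1+|v|²)`-small perturbation of the observable.
* `KineticWindowLDStaticTilt` — the transfer target `C⁺`: the POINTWISE kinetic window LD (no
  families, no `s`) with the tilt threshold `β₀` chosen from A-PRIORI BOUNDS `Θ` only.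
* `SuprathermalWindowTightness` — the tail input: scale-`N` exponential tightness of the
  window-averaged suprathermal kinetic energy under local Gibbs data (static at global Gibbs).
* `StaticTiltTransfer` — the line's concluding implication (to become `KineticCurrentsLDAlongFamilies_of`).
-/

noncomputable section

namespace Summit.AtomisticToContinuum.HydrodynamicLimit.Cruxes.KineticCurrentsLDAlongFamilies.IdeatorOneSketch

open MeasureTheory
open scoped ENNReal
open Literature.Analysis.FluidPDE Literature.MathematicalPhysics.KineticTheory

/-- The hard-sphere flows of the crux: `N + 1` spheres of diameter `σ (N+1)^{-1/3}` on `𝕋³`. -/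
abbrev Flow (σ : ℝ) (N : ℕ) : Type :=
  HardSphereFlow (Torus.geometry (Fin 3)) (hsDiameter σ N) (N + 1)

/-- Phase space of `N + 1` spheres on `𝕋³`. -/
abbrev Cfg (N : ℕ) : Type := Config (N + 1) (Fin 3) T3

/-- The kinetic window `w_N = τ (N+1)^{-1/3}`. -/
def window (τ : ℝ) (N : ℕ) : ℝ := τ * ((N : ℝ) + 1) ^ (-(1 / 3 : ℝ))

/-- The window functional `X(F)(z) = Σ_i w⁻¹ ∫₀ʷ F((Φ_r z)_i) dr` of a one-body observable. -/
def windowAvg {σ : ℝ} {N : ℕ} (Φ : Flow σ N) (τ : ℝ) (F : T3 × V3 → ℝ) (z : Cfg N) : ℝ :=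
  ∑ i : Fin (N + 1), (window τ N)⁻¹ * ∫ r in (0 : ℝ)..(window τ N), F ((Φ.flow r z) i)

/-- The crux's restricted class at a fixed profile point: `F(x,v) = A(x):(w⊗w) + (b(x)·w) G(x,|w|²)`,
`w = v − u₀(x)`. -/
def classFun (u₀ : T3 → V3) (A : T3 → Fin 3 → Fin 3 → ℝ) (b : T3 → V3) (G : T3 × ℝ → ℝ) :
    T3 × V3 → ℝ :=
  fun y => (∑ j : Fin 3, ∑ k : Fin 3, A y.1 j k * ((y.2 - u₀ y.1) j * (y.2 - u₀ y.1) k)) +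
    (∑ j : Fin 3, b y.1 j * (y.2 - u₀ y.1) j) * G (y.1, ‖y.2 - u₀ y.1‖ ^ 2)

/-- The suprathermal excess observable `(|v|² − M)₊` (continuous, nonnegative, speeds only). -/
def suprathermal (M : ℝ) : T3 × V3 → ℝ := fun y => max (‖y.2‖ ^ 2 - M) 0

/-- **FIRST LEMMA (static): Hölder–Rényi continuity of canonical local Gibbs laws in the
profiles, uniformly in `N`.** For a-priori bounds `Θ`, a Hölder exponent `p > 1` and a rate
`γ > 0` there is `δ > 0` such that for any two continuous profile triples within the bounds and
`δ`-close in sup norm, ANY nonnegative measurable phase-space functional transfers between the two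
laws at the price `β ↦ pβ` (the `L^p` norm) and `e^{γ(N+1)}` — for every `σ`, `N`, `Φ`.
Proof sketch: `dλ/dλ' = (Z'/Z) ∏ᵢ (a M_{u,θ})/(a' M_{u',θ'})(zᵢ)` on the common hard-sphere
domain; given positions the velocities under `λ'` are independent Gaussians, so
`‖dλ/dλ'‖_{L^{p'}(λ')} ≤ exp((N+1)·[sup|log a/a'| (1 + 1/p') + sup_x (1/p') log ∫ M^{p'} M'^{1−p'} dv])`,
and the Gaussian integral is finite iff `p'/θ − (p'−1)/θ' > 0` (true for `δ < 1/(Θ(p'−1))`) and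
tends to `1` uniformly on the `Θ`-compact as `δ → 0`. -/
def RenyiTransferLocalGibbs : Prop :=
  ∀ (Θ p : ℝ), 1 < Θ → 1 < p → ∀ γ : ℝ, 0 < γ → ∃ δ : ℝ, 0 < δ ∧
    ∀ (a a' θ θ' : T3 → ℝ) (u u' : T3 → V3),
      Continuous a → Continuous a' → Continuous θ → Continuous θ' → Continuous u → Continuous u' →
      (∀ x, Θ⁻¹ ≤ a x ∧ a x ≤ Θ) → (∀ x, Θ⁻¹ ≤ a' x ∧ a' x ≤ Θ) →
      (∀ x, Θ⁻¹ ≤ θ x ∧ θ x ≤ Θ) → (∀ x, Θ⁻¹ ≤ θ' x ∧ θ' x ≤ Θ) →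
      (∀ x, ‖u x‖ ≤ Θ) → (∀ x, ‖u' x‖ ≤ Θ) →
      (∀ x, |a x - a' x| ≤ δ ∧ |θ x - θ' x| ≤ δ ∧ ‖u x - u' x‖ ≤ δ) →
      ∀ (σ : ℝ) (N : ℕ) (Φ : Flow σ N) (Ψ : Cfg N → ℝ≥0∞), Measurable Ψ →
        ∫⁻ z, Ψ z ∂(localGibbsLaw σ a u θ N Φ) ≤
          (∫⁻ z, (Ψ z) ^ p ∂(localGibbsLaw σ a' u' θ' N Φ)) ^ (1 / p) *
            ENNReal.ofReal (Real.exp (γ * ((N : ℝ) + 1)))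

/-- **Second static lemma (observable side): weighted closure along the flow.** On good orbits
kinetic energy is conserved (`IsHardSphereTrajectory.configEnergy_eq_holds`), so a perturbation of
the observable bounded by `η(1+|v|²)` moves the window functional by at most
`η((N+1) + 2·configEnergy z)` — a STATIC quantity of the initial datum, whatever the window. -/
def WeightedClosureAlongFlow : Prop :=
  ∀ (σ : ℝ) (N : ℕ) (Φ : Flow σ N) (F F' : T3 × V3 → ℝ), Continuous F → Continuous F' →
    ∀ η : ℝ, (∀ y, |F y - F' y| ≤ η * (1 + ‖y.2‖ ^ 2)) →
    ∀ τ : ℝ, 0 < τ → ∀ z ∈ Φ.good,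
      |windowAvg Φ τ F z - windowAvg Φ τ F' z| ≤ η * (((N : ℝ) + 1) + 2 * configEnergy z)

/-- **`C⁺` — the pointwise kinetic window LD with an A-PRIORI tilt threshold** (transfer target).
The crux's constant-family rung `KineticCurrentsWindowLDUniform` (stmt-14662) with two changes and
nothing else: the window quantifier is the crux's `∃τ₀ ∀τ ≥ τ₀`, and `β₀` is chosen from the
a-priori bounds `Θ` on `(a, θ₀, u₀)` and on the class constant BEFORE the profiles and the weights
(every other threshold — `τ₀`, `N₀` — stays pointwise in the data). No families, no `s`. -/
def KineticWindowLDStaticTilt : Prop :=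
  ∃ η₀ : ℝ, 0 < η₀ ∧ ∀ σ : ℝ, 0 < σ → ∀ Φ : (N : ℕ) → Flow σ N, ∀ Θ : ℝ, 1 < Θ →
    ∃ β₀ : ℝ, 0 < β₀ ∧
    ∀ (a θ₀ : T3 → ℝ) (u₀ : T3 → V3), Continuous a → Continuous θ₀ → Continuous u₀ →
      (∀ x, Θ⁻¹ ≤ a x ∧ a x ≤ Θ) → (∀ x, Θ⁻¹ ≤ θ₀ x ∧ θ₀ x ≤ Θ) → (∀ x, ‖u₀ x‖ ≤ Θ) →
      σ ^ 3 * (⨆ x, a x) ≤ η₀ * ∫ x, a x →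
      ∀ (A : T3 → Fin 3 → Fin 3 → ℝ) (b : T3 → V3) (G : T3 × ℝ → ℝ),
        Continuous A → Continuous b → Continuous G →
        (∀ y, |classFun u₀ A b G y| ≤ Θ * (1 + ‖y.2‖ ^ 2)) →
        (∀ x, ∫ v, classFun u₀ A b G (x, v) * localMaxwellian 1 (θ₀ x) (u₀ x) v = 0) →
        (∀ x (j : Fin 3), ∫ v, classFun u₀ A b G (x, v) * v j * localMaxwellian 1 (θ₀ x) (u₀ x) v = 0) →
        (∀ x, ∫ v, classFun u₀ A b G (x, v) * ‖v‖ ^ 2 * localMaxwellian 1 (θ₀ x) (u₀ x) v = 0) →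
        ∀ β : ℝ, |β| ≤ β₀ → ∀ ε : ℝ, 0 < ε → ∃ τ₀ : ℝ, 0 < τ₀ ∧ ∀ τ : ℝ, τ₀ ≤ τ →
          ∃ N₀ : ℕ, ∀ N : ℕ, N₀ ≤ N →
            ∫⁻ z, ENNReal.ofReal (Real.exp (β * windowAvg (Φ N) τ (classFun u₀ A b G) z))
                ∂(localGibbsLaw σ a u₀ θ₀ N (Φ N)) ≤
              ENNReal.ofReal (Real.exp (ε * ((N : ℝ) + 1)))

/-- **The tail input: suprathermal window tightness under local Gibbs data.** With a tilt
threshold `κ₀` from a-priori bounds only, the scale-`N` pressure of the window-averaged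
suprathermal excess `Σᵢ w⁻¹∫₀ʷ (|vᵢ(r)|² − M)₊ dr` is `≤ ε` once `M ≥ M(ε)`, for every fixed
window `τ` and `N ≥ N₀(τ)`. At constant profiles this is flow-invariance + Jensen in time + a
Gaussian tail (provable now); under local data it is the kinetic-window, quadratic, small-tilt
shard of Nachtergaele–Yau's high-momentum assumption, implied by Rényi quasi-invariance of the
local Gibbs law over the window at any order `p > 1`. -/
def SuprathermalWindowTightness : Prop :=
  ∃ η₀ : ℝ, 0 < η₀ ∧ ∀ σ : ℝ, 0 < σ → ∀ Φ : (N : ℕ) → Flow σ N, ∀ Θ : ℝ, 1 < Θ →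
    ∃ κ₀ : ℝ, 0 < κ₀ ∧
    ∀ (a θ₀ : T3 → ℝ) (u₀ : T3 → V3), Continuous a → Continuous θ₀ → Continuous u₀ →
      (∀ x, Θ⁻¹ ≤ a x ∧ a x ≤ Θ) → (∀ x, Θ⁻¹ ≤ θ₀ x ∧ θ₀ x ≤ Θ) → (∀ x, ‖u₀ x‖ ≤ Θ) →
      σ ^ 3 * (⨆ x, a x) ≤ η₀ * ∫ x, a x →
      ∀ ε : ℝ, 0 < ε → ∃ M : ℝ, ∀ τ : ℝ, 0 < τ → ∃ N₀ : ℕ, ∀ N : ℕ, N₀ ≤ N →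
        ∫⁻ z, ENNReal.ofReal (Real.exp (κ₀ * windowAvg (Φ N) τ (suprathermal M) z))
            ∂(localGibbsLaw σ a u₀ θ₀ N (Φ N)) ≤
          ENNReal.ofReal (Real.exp (ε * ((N : ℝ) + 1)))

/-- **The line's conclusion** (to become `KineticCurrentsLDAlongFamilies_of` in crux-plan): the
family-uniform crux follows from the pointwise statement with a-priori tilt threshold and the tail
input, by a Lebesgue-number cover of `[0, t₁]`, `RenyiTransferLocalGibbs`,
`WeightedClosureAlongFlow`, a three-factor Hölder and static Gaussian bounds. -/
def StaticTiltTransfer : Prop :=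
  KineticWindowLDStaticTilt → SuprathermalWindowTightness →
    Summit.AtomisticToContinuum.HydrodynamicLimit.Theses.OneFlightGossipEngine.KineticCurrentsLDAlongFamilies

/-- **The crux restricted to TAME families — bounded radial weights `G`** (one extra clause,
`∃ B, ∀ s x e, 0 ≤ e → |G s (x,e)| ≤ B`, inserted after the continuity of `G`; everything else is
the route decl `KineticCurrentsLDAlongFamilies` verbatim). This is exactly what the consumer feeds:
the heart's kinetic instance KC1 takes `G` from `LoHeatFluxCutoffFamily`, whose second clause is
`∃ C, ∀ s y, 0 ≤ y.2 → |G s y| ≤ C`. For tame families the transfer needs NO tail input. -/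
def KineticCurrentsLDAlongFamiliesBdd : Prop :=
  ∃ η₀ : ℝ, 0 < η₀ ∧ ∀ (t₁ : ℝ) (a θ₀ : ℝ → T3 → ℝ) (u₀ : ℝ → T3 → V3),
    Continuous (Function.uncurry a) → Continuous (Function.uncurry θ₀) → Continuous (Function.uncurry u₀) →
    (∀ s x, 0 < a s x) → (∀ s x, 0 < θ₀ s x) →
    ∀ σ : ℝ, 0 < σ → (∀ s ∈ Set.Icc 0 t₁, σ ^ 3 * (⨆ x, a s x) ≤ η₀ * ∫ x, a s x) →
    ∀ Φ : (N : ℕ) → Flow σ N,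
    ∀ (A : ℝ → T3 → Fin 3 → Fin 3 → ℝ) (b : ℝ → T3 → V3) (G : ℝ → T3 × ℝ → ℝ),
    Continuous (Function.uncurry A) → Continuous (Function.uncurry b) → Continuous (Function.uncurry G) →
    (∃ B : ℝ, ∀ (s : ℝ) (x : T3) (e : ℝ), 0 ≤ e → |G s (x, e)| ≤ B) →
    (let F := fun (s : ℝ) (y : T3 × V3) =>
       (∑ j : Fin 3, ∑ k : Fin 3, A s y.1 j k * ((y.2 - u₀ s y.1) j * (y.2 - u₀ s y.1) k)) +
         (∑ j : Fin 3, b s y.1 j * (y.2 - u₀ s y.1) j) * G s (y.1, ‖y.2 - u₀ s y.1‖ ^ 2)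
     (∃ C : ℝ, ∀ s ∈ Set.Icc 0 t₁, ∀ y : T3 × V3, |F s y| ≤ C * (1 + ‖y.2‖ ^ 2)) →
     (∀ s ∈ Set.Icc 0 t₁, ∀ x, ∫ v, F s (x, v) * localMaxwellian 1 (θ₀ s x) (u₀ s x) v = 0) →
     (∀ s ∈ Set.Icc 0 t₁, ∀ x (j : Fin 3),
        ∫ v, F s (x, v) * v j * localMaxwellian 1 (θ₀ s x) (u₀ s x) v = 0) →
     (∀ s ∈ Set.Icc 0 t₁, ∀ x, ∫ v, F s (x, v) * ‖v‖ ^ 2 * localMaxwellian 1 (θ₀ s x) (u₀ s x) v = 0) →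
     ∃ β₀ : ℝ, 0 < β₀ ∧ ∀ β : ℝ, |β| ≤ β₀ → ∀ ε : ℝ, 0 < ε → ∃ τ₀ : ℝ, 0 < τ₀ ∧ ∀ τ : ℝ, τ₀ ≤ τ →
     ∃ N₀ : ℕ, ∀ N : ℕ, N₀ ≤ N → ∀ s ∈ Set.Icc 0 t₁,
       ∫⁻ z, ENNReal.ofReal (Real.exp (β * ∑ i : Fin (N + 1),
           (τ * ((N : ℝ) + 1) ^ (-(1 / 3 : ℝ)))⁻¹ *
             ∫ r in (0 : ℝ)..(τ * ((N : ℝ) + 1) ^ (-(1 / 3 : ℝ))), F s ((Φ N).flow r z i)))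
         ∂(localGibbsLaw σ (a s) (u₀ s) (θ₀ s) N (Φ N)) ≤
       ENNReal.ofReal (Real.exp (ε * ((N : ℝ) + 1))))

/-- **The tame transfer** (first target of the crux-plan line; purely static): for bounded radial
weights the pointwise statement with a-priori tilt threshold ALONE gives the family-uniform one. -/
def TameStaticTiltTransfer : Prop :=
  KineticWindowLDStaticTilt → KineticCurrentsLDAlongFamiliesBdd

/-! ### Sanity facts (cheap, proved) -/

/-- The tame statement is literally weaker than the crux (the extra clause is discarded). -/
theorem bdd_of_crux
    (h : Summit.AtomisticToContinuum.HydrodynamicLimit.Theses.OneFlightGossipEngine.KineticCurrentsLDAlongFamilies) :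
    KineticCurrentsLDAlongFamiliesBdd := by
  obtain ⟨η₀, hη₀, H⟩ := h
  refine ⟨η₀, hη₀, ?_⟩
  intro t₁ a θ₀ u₀ ha hθ hu hapos hθpos σ hσ hguard Φ A b G hA hb hG _hB
  exact H t₁ a θ₀ u₀ ha hθ hu hapos hθpos σ hσ hguard Φ A b G hA hb hG


/-- The suprathermal excess is nonnegative. -/
theorem suprathermal_nonneg (M : ℝ) (y : T3 × V3) : 0 ≤ suprathermal M y :=
  le_max_right _ _

/-- The suprathermal excess is continuous. -/
theorem continuous_suprathermal (M : ℝ) : Continuous (suprathermal M) := by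
  unfold suprathermal
  fun_prop

/-- The tail domination used by the transfer: `(1 + |v|²)·𝟙{|v|² > 2M+1} ≤ 2 (|v|² − M)₊`. -/
theorem one_add_sq_indicator_le (M e : ℝ) (he : 2 * M + 1 < e) : 1 + e ≤ 2 * max (e - M) 0 := by
  have h : e - M ≤ max (e - M) 0 := le_max_left _ _
  linarith

/-- The two-factor Hölder inequality for lower integrals in the form the transfer uses
(Mathlib's `ENNReal.lintegral_mul_le_Lp_mul_Lq`). -/
theorem holder_two {α : Type*} [MeasurableSpace α] (μ : Measure α) {p q : ℝ}
    (hpq : p.HolderConjugate q) {f g : α → ℝ≥0∞} (hf : AEMeasurable f μ) (hg : AEMeasurable g μ) :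
    ∫⁻ a, (f * g) a ∂μ ≤ (∫⁻ a, f a ^ p ∂μ) ^ (1 / p) * (∫⁻ a, g a ^ q ∂μ) ^ (1 / q) :=
  ENNReal.lintegral_mul_le_Lp_mul_Lq μ hpq hf hg

/-! ### The observable-side lemma is provable now -/

/-- **`WeightedClosureAlongFlow` holds** (energy conservation on good orbits + time-measurability of
the orbit; the tree's `abs_sum_window_integral_le` applied to `F − F'`). -/
theorem weightedClosureAlongFlow_holds : WeightedClosureAlongFlow := by
  intro σ N Φ F F' hF hF' η hη τ hτ z hz
  have hw : 0 < window τ N := by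
    unfold window
    exact mul_pos hτ (Real.rpow_pos_of_pos (by positivity) _)
  have hγ : Measurable fun t => Φ.flow t z := (Φ.isTrajectory z hz).measurable_torus
  have hpath : ∀ i : Fin (N + 1), Measurable fun r => Φ.flow r z i := fun i =>
    (measurable_pi_apply i).comp hγ
  -- the orbit stays in a compact set (positions compact, speeds bounded by the conserved energy)
  set R : ℝ := Real.sqrt (2 * configEnergy z) with hR
  have hK : IsCompact ((Set.univ : Set T3) ×ˢ Metric.closedBall (0 : V3) R) :=
    isCompact_univ.prod (isCompact_closedBall _ _)
  have hmem : ∀ (i : Fin (N + 1)) (r : ℝ),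
      Φ.flow r z i ∈ (Set.univ : Set T3) ×ˢ Metric.closedBall (0 : V3) R := by
    intro i r
    refine ⟨Set.mem_univ _, ?_⟩
    rw [Metric.mem_closedBall, dist_zero_right]
    have h1 : ‖(Φ.flow r z i).2‖ ^ 2 ≤ 2 * configEnergy z := by
      have h := norm_vel_sq_le_two_mul_configEnergy (Φ.flow r z) i
      rwa [Φ.configEnergy_flow hz r] at h
    calc ‖(Φ.flow r z i).2‖ = Real.sqrt (‖(Φ.flow r z i).2‖ ^ 2) := by
          rw [Real.sqrt_sq (norm_nonneg _)]
      _ ≤ Real.sqrt (2 * configEnergy z) := Real.sqrt_le_sqrt h1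
  have hint : ∀ H : T3 × V3 → ℝ, Continuous H → ∀ i : Fin (N + 1),
      IntervalIntegrable (fun r => H (Φ.flow r z i)) volume 0 (window τ N) := by
    intro H hH i
    obtain ⟨B, hB⟩ := hK.exists_bound_of_continuousOn hH.continuousOn
    refine (intervalIntegrable_const (c := B)).mono_fun'
      ((hH.measurable.comp (hpath i)).aestronglyMeasurable) ?_
    exact ae_of_all _ fun r => hB _ (hmem i r)
  have hD : ∀ y : T3 × V3, |(fun y => F y - F' y) y| ≤ η * (1 + ‖y.2‖ ^ 2) := fun y => hη y
  have key := Summit.AtomisticToContinuum.HydrodynamicLimit.Theorems.abs_sum_window_integral_le Φ hz hD hw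
  have hdiff : windowAvg Φ τ F z - windowAvg Φ τ F' z =
      ∑ i : Fin (N + 1), (window τ N)⁻¹ *
        ∫ r in (0 : ℝ)..(window τ N), (fun y => F y - F' y) (Φ.flow r z i) := by
    unfold windowAvg
    rw [← Finset.sum_sub_distrib]
    refine Finset.sum_congr rfl fun i _ => ?_
    rw [← mul_sub, ← intervalIntegral.integral_sub (hint F hF i) (hint F' hF' i)]
  rw [hdiff]
  refine key.trans_eq ?_
  push_cast
  ring

end Summit.AtomisticToContinuum.HydrodynamicLimit.Cruxes.KineticCurrentsLDAlongFamilies.IdeatorOneSketch
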